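import Summits.Ventures.QEC.Census.BB.BB144.BZAutDataZ1
import Summits.Ventures.QEC.Census.BB.BB144.BZAutDataZ2
import Summits.Ventures.QEC.Census.BB.BB144.BZData
import Summits.Ventures.QEC.Census.BB.BB144.Cert
import HarnessLib

/-!
# `BB144` — `bz` certificate data (CERT-FORMAT v1 §3 `k_cert` + `logicals` + §5.3 `params`), emitted by qec-search-7

The `BZData` literal of `Census/CertCheckBZ.lean` for the certificate `7c1e929a56946658` (kernel A, method `bz_aut`: 15 blocks, t = (4,5), parity witness, translations of ℤ₁₂×ℤ₆): the two
rank certificates (type-02's `RankCert`), the paired logical bases `LX`, `LZ` (12 words each), and the sides'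
blocks (in the part files `BZAutData<S><k>.lean`). DATA only; every literal is re-checked by the Lean words
(`bzZStruct`, `bzZBlock`, …). Source: HOME/cert/BB144.bzaut.certA.json; emitter HOME/census/search-7/emit_bz.py.
-/

namespace Summit.Ventures.QEC.Census.BB144



/-- The `bz_aut` data of `BB144`: rank certificates, logical bases (words over the 144 qubits), sides (rank certificates and logical bases = those of `bzData`, the same certificate family; automorphisms and the cover witness table are in `BZAutCover<S>.lean`). -/
def bzAutData : BZData where
  rcX := rcX
  rcZ := rcZ
  LX := bzData.LX
  LZ := bzData.LZ
  sideZ := { evenWitness := some [1, 2, 6, 7, 8, 10, 12, 14, 16, 17, 18, 19, 21, 23, 26, 27, 30, 31, 37, 38, 42, 43, 44, 46, 48, 50, 52, 53, 54, 55, 57, 59, 62, 63, 66, 67],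
             blocks := [bzAutBlockZ0, bzAutBlockZ1, bzAutBlockZ2, bzAutBlockZ3, bzAutBlockZ4, bzAutBlockZ5, bzAutBlockZ6, bzAutBlockZ7,
      bzAutBlockZ8, bzAutBlockZ9, bzAutBlockZ10, bzAutBlockZ11, bzAutBlockZ12, bzAutBlockZ13, bzAutBlockZ14] }
  sideX := { evenWitness := none, blocks := [] }

end Summit.Ventures.QEC.Census.BB144
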